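import Mathlib
import HarnessLib
import Summits.NavierStokesRegularity.NavierStokesRegularity.Theorems.PoloidalWindowDoorPoloidalWindowRigiditySparseEnergyFarField

/-!
# Route `PoloidalWindowDoor`, crux `PoloidalWindowRigidity` (stmt-19708), line `sparse_energy` (cstrat g11) —
# stub S1 `stub_scaledEnergy`, the ROUND INTERFACE: cut-off energy at `t₀` from the far half at `s` plus ANY flux bound on the window `(s, t₀]`

Seat ns-poloidal-K2-p2 g9 (successor of the interim LEAD-of-record on 19708; file `--supports`).  `…SparseEnergyFarField` closed the far half
of S1 (`−t₀ ≥ R²`) with the sup-rate flux bound of `…SparseEnergyFarFlux.abs_flux_le`.  The near-apex half is a bootstrap in the radius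
(line card §Stubs, S1-NEAR-DESIGN-K2p2-g9 §2): each round feeds a better a-priori envelope `E(ρ,t) ≤ Φ(ρ,t)` into a SHARPER flux bound on the
window (cubic and pressure fluxes linear in `E`, far-field pressure through a dyadic sum; the pressure representation is being typed by
ns-es-p1 as `Literature/…/RieszPressureModConst`).  This file is the pressure-agnostic interface every round uses:

* `cutoffEnergy_le_of_fluxBound` — for a profile of the class, a window pressure `q` on `(T,0)`, the cut-off `ψ = cutoff R (a − ·)`, times
  `T < s ≤ t₀ < 0` and ANY function `G` with `|F(t)| ≤ G t` on `(s, t₀]` (`F` = the slice flux of the local energy identity) and `G` interval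
  integrable:  `∫ ψ|v(t₀)|² + 2∫_s^{t₀}∫ |Dv|²_F ψ ≤ ∫ ψ|v(s)|² + ∫_s^{t₀} G`  (the identity + `norm_integral_le_of_norm_le`);
* `cutoffEnergy_le_far_add_fluxBound` — the same with the initial term at `s` replaced by the FAR-HALF bound of `…FarField.cutoffEnergy_dissipation_le`
  (`∫ ψ|v(s)|² ≤ A R²/√(−s) + B R³/(−s)`, so at `s = −R²` it is `≤ (A + B)·R`): the «round» of the bootstrap as a one-line consumer.

WHAT THIS IS NOT: not a claim about Navier–Stokes, not S1 — bookkeeping for its near-apex half (bears_on LADDER-NS N0 via crux 19708, line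
sparse_energy, stub S1). [folklore]
-/

noncomputable section

-- the summit and its single sub-problem share the name (CONVENTIONS §1), as in every Theorems file
set_option linter.dupNamespace false

namespace Summit.NavierStokesRegularity.NavierStokesRegularity.Theorems.PoloidalWindowDoorPoloidalWindowRigiditySparseEnergyWindow

open MeasureTheory Set Function Filter Topology Metric InnerProductSpace
open scoped RealInnerProductSpace InnerProductSpace Laplacian ENNReal
open Literature.Analysis Literature.Analysis.FluidPDE
open Summit.NavierStokesRegularity.NavierStokesRegularity.Theorems.PoloidalWindowDoorPoloidalWindowRigiditySparseEnergyFarFlux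
open Summit.NavierStokesRegularity.NavierStokesRegularity.Theorems.PoloidalWindowDoorPoloidalWindowRigiditySparseEnergyFarField

variable {C : ℝ} {v : ℝ → EuclideanSpace ℝ (Fin 3) → EuclideanSpace ℝ (Fin 3)}

/-- **THE ROUND INTERFACE.**  Local energy identity on `[s, t₀] ⊆ (T, 0)` for a classical window pressure `q` and the cut-off
`ψ = cutoff R (a − ·)`, with the flux replaced by ANY integrable majorant `G` on `(s, t₀]`:
`∫ ψ|v(t₀)|² + 2∫_s^{t₀}∫ |Dv|²_F ψ ≤ ∫ ψ|v(s)|² + ∫_s^{t₀} G`. [folklore] -/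
theorem cutoffEnergy_le_of_fluxBound {T : ℝ} {q : ℝ → EuclideanSpace ℝ (Fin 3) → ℝ}
    (hcl : IsClassicalNSSolutionOn (Ioo T 0) 1 0 v q) {a : EuclideanSpace ℝ (Fin 3)} {R : ℝ} (hR : 0 < R)
    {s t₀ : ℝ} (hTs : T < s) (hst : s ≤ t₀) (ht₀ : t₀ < 0) {G : ℝ → ℝ} (hGi : IntervalIntegrable G volume s t₀)
    (hG : ∀ t ∈ Ioc s t₀,
      |∫ x, ((Δ (fun x => cutoff R (a - x))) x * ‖v t x‖ ^ 2 + fderiv ℝ (fun x => cutoff R (a - x)) x (v t x) * ‖v t x‖ ^ 2 +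
        2 * (q t x * fderiv ℝ (fun x => cutoff R (a - x)) x (v t x)))| ≤ G t) :
    (∫ x, cutoff R (a - x) * ‖v t₀ x‖ ^ 2) + 2 * ∫ t in s..t₀, ∫ x, frobeniusNormSq (fderiv ℝ (v t) x) * cutoff R (a - x) ≤
      (∫ x, cutoff R (a - x) * ‖v s x‖ ^ 2) + ∫ t in s..t₀, G t := by
  set ψ : EuclideanSpace ℝ (Fin 3) → ℝ := fun x => cutoff R (a - x) with hψ
  have hψC : ContDiff ℝ ((⊤ : ℕ∞) : WithTop ℕ∞) ψ := cutoffT_contDiff hψ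
  have hψc : HasCompactSupport ψ := cutoffT_hasCompactSupport hψ hR
  have hI : Icc s t₀ ⊆ Ioo T 0 := fun t ht => ⟨lt_of_lt_of_le hTs ht.1, lt_of_le_of_lt ht.2 ht₀⟩
  have hid := hcl.local_energy_identity_cutoff isOpen_Ioo hψC hψc hst hI
  simp only [one_mul, mul_one] at hid
  have hF : |∫ t in s..t₀, ∫ x, ((Δ ψ) x * ‖v t x‖ ^ 2 + fderiv ℝ ψ x (v t x) * ‖v t x‖ ^ 2 +
      2 * (q t x * fderiv ℝ ψ x (v t x)))| ≤ ∫ t in s..t₀, G t := by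
    rw [← Real.norm_eq_abs]
    refine intervalIntegral.norm_integral_le_of_norm_le hst (Eventually.of_forall fun t ht => ?_) hGi
    rw [Real.norm_eq_abs]
    exact hG t ht
  have habs := le_abs_self (∫ t in s..t₀, ∫ x, ((Δ ψ) x * ‖v t x‖ ^ 2 + fderiv ℝ ψ x (v t x) * ‖v t x‖ ^ 2 +
      2 * (q t x * fderiv ℝ ψ x (v t x))))
  show (∫ x, ψ x * ‖v t₀ x‖ ^ 2) + 2 * ∫ t in s..t₀, ∫ x, frobeniusNormSq (fderiv ℝ (v t) x) * ψ x ≤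
      (∫ x, ψ x * ‖v s x‖ ^ 2) + ∫ t in s..t₀, G t
  linarith

/-- **THE ROUND, CONSUMER FORM.**  Far half at time `s` plus any flux majorant on `(s, t₀]`:
`∫ ψ|v(t₀)|² + 2∫_s^{t₀}∫ |Dv|²_F ψ ≤ A R²/√(−s) + B R³/(−s) + ∫_s^{t₀} G` with the constants `A, B` of
`…FarField.cutoffEnergy_dissipation_le` (so at `s = −R²` the first two terms are `≤ (A + B)·R`). [folklore] -/
theorem cutoffEnergy_le_far_add_fluxBound (hrate : HasTypeITimeDecay C v)
    (hcont : ContinuousOn (uncurry v) (Iio (0 : ℝ) ×ˢ univ))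
    (hmild : ∀ s t : ℝ, s < t → t < 0 → ∀ x,
      v t x = UnboundedOperators.heatExtension (v s) (t - s) x - oseenDuhamel 1 s v v t x)
    (hdiv : ∀ t < 0, VectorCalculus.IsDivFree (v t)) :
    ∃ A B : ℝ, 0 ≤ A ∧ 0 ≤ B ∧ ∀ (T : ℝ) (q : ℝ → EuclideanSpace ℝ (Fin 3) → ℝ), IsClassicalNSSolutionOn (Ioo T 0) 1 0 v q →
      ∀ (a : EuclideanSpace ℝ (Fin 3)) (R : ℝ), 0 < R → ∀ s t₀ : ℝ, T < s → s ≤ t₀ → t₀ < 0 →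
      ∀ G : ℝ → ℝ, IntervalIntegrable G volume s t₀ →
        (∀ t ∈ Ioc s t₀,
          |∫ x, ((Δ (fun x => cutoff R (a - x))) x * ‖v t x‖ ^ 2 + fderiv ℝ (fun x => cutoff R (a - x)) x (v t x) * ‖v t x‖ ^ 2 +
            2 * (q t x * fderiv ℝ (fun x => cutoff R (a - x)) x (v t x)))| ≤ G t) →
        (∫ x, cutoff R (a - x) * ‖v t₀ x‖ ^ 2) + 2 * ∫ t in s..t₀, ∫ x, frobeniusNormSq (fderiv ℝ (v t) x) * cutoff R (a - x) ≤
          A * R ^ 2 / Real.sqrt (-s) + B * R ^ 3 / (-s) + ∫ t in s..t₀, G t := by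
  obtain ⟨A, B, hA, hB, hfar⟩ := cutoffEnergy_dissipation_le hrate hcont hmild hdiv
  refine ⟨A, B, hA, hB, fun T q hcl a R hR s t₀ hTs hst ht₀ G hGi hG => ?_⟩
  have hs0 : s < 0 := lt_of_le_of_lt hst ht₀
  have hEs := (hfar a R hR (s - 1) s (by linarith) hs0).1
  have hround := cutoffEnergy_le_of_fluxBound hcl hR hTs hst ht₀ hGi hG
  linarith

end Summit.NavierStokesRegularity.NavierStokesRegularity.Theorems.PoloidalWindowDoorPoloidalWindowRigiditySparseEnergyWindow

end
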